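import Summits.BirchSwinnertonDyer.BirchSwinnertonDyer.Theorems.ResidualThetaTransportAtTwoAwayDefs
import HarnessLib

/-!
# Sketch (stub-ideation k = 1, gen 20, family 2 «weaken / strengthen») for `stub_cmLambdaLower` = RSL_g
# (stmt-BirchSwinnertonDyer-22608) on crux (R≥)ᵖ `ResidualThetaCountLowerPureAtTwo` (stmt-BirchSwinnertonDyer-26074)

THE SLACK RING OF THE PLACE CUT. GLUE-SPEC-g18 §2 (1) resolves the open point «`ℤ₂` on `↥selRelSubgroup`?» by
running `PlaceCutGlue.hDHrel_of_placeCut` and `RelaxedDeepHalf.deepHalfSigma_of_relaxed` with `A := ℤ` (the cut only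
needs `a₀ • s` on Selmer classes). But the cut's INPUTS `h2 := S4₂` (`stub_deepHalfAtTwoStrict`, closed p702488) and
`h0 := S4₀` (`stub_deepHalfAwayTwo`) are REGISTERED with a 2-ADIC slack `∃ a : ℤ_[2], a ≠ 0 ∧ …`, while at `A := ℤ`
the cut consumes an INTEGER slack (`ht (a₀ • s)`, `s : SelRel` a bare `AddSubgroup`). This file proves the missing
adapter in its weakest form and shows it is an equivalence:

* §1 (generic, any `p`): along any map `f : H → M` into a `ℤ_[p]`-module that is compatible with SOME self-map family
  `act : ℤ_[p] → H → H` (`f (act a x) = a • f x` — no module axioms on `H` are needed), a 2-adic slack descends to a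
  power-of-`p` slack (unit stripping, `PadicInt.unitCoeff`), hence to an integer slack; an integer slack ascends to a
  2-adic slack by the cast. So «`ℤ_[p]`-slack ⟺ `ℤ`-slack ⟺ `p^v`-slack» (strongest form), also with a side condition
  `P x` stable under `act` (the S4₂ clause `locdS x = 0`).
* §2 (the line's currency, verbatim binders of `Theorems/ResidualThetaTransportAtTwoAwayDefs.lean`): the S4₀ conclusion
  `∃ a : ℤ_[2], a ≠ 0 ∧ ∃ x : I.H, a • χ = πₐ.locdS x` yields `∃ m : ℤ, m ≠ 0 ∧ ∃ x : I.H, m • χ = πₐ.locdS x` from the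
  package field `AwayPins.hlocdS_smul` ALONE; the S4₂ conclusion likewise, given the `ℤ₂`-compatibility of `π.locd₂`
  (the landed `locd₂_C_smul_eq_smul`, `…RhoLayerPairingCoeffSmul.lean`).

Theorems only; no `sorry`, no instance, no notation. BSD is not proved by any of this; RSL_g (22608) and (R≥)ᵖ (26074) stay OPEN.
-/

set_option autoImplicit false
set_option linter.dupNamespace false

noncomputable section

open scoped Classical

namespace Summit.BirchSwinnertonDyer.BirchSwinnertonDyer.Cruxes.ResidualThetaCountLowerPureAtTwo.SideaK1G20

/-! ## §1 Generic slack-ring descent / ascent along a `ℤ_[p]`-compatible map -/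

section Generic

variable {p : ℕ} [Fact p.Prime] {H M : Type*} [AddCommGroup M] [Module ℤ_[p] M]

/-- Unit stripping: `↑(unitCoeff ha)⁻¹ * a = p ^ v(a)`. -/
theorem unitCoeff_inv_mul_eq_pow {a : ℤ_[p]} (ha : a ≠ 0) :
    (((PadicInt.unitCoeff ha)⁻¹ : ℤ_[p]ˣ) : ℤ_[p]) * a = (p : ℤ_[p]) ^ a.valuation := by
  have hu := PadicInt.unitCoeff_spec ha
  calc (((PadicInt.unitCoeff ha)⁻¹ : ℤ_[p]ˣ) : ℤ_[p]) * a
      = (((PadicInt.unitCoeff ha)⁻¹ : ℤ_[p]ˣ) : ℤ_[p]) * ((PadicInt.unitCoeff ha : ℤ_[p]ˣ) * (p : ℤ_[p]) ^ a.valuation) :=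
        congrArg (fun b : ℤ_[p] ↦ (((PadicInt.unitCoeff ha)⁻¹ : ℤ_[p]ˣ) : ℤ_[p]) * b) hu
    _ = (p : ℤ_[p]) ^ a.valuation := by rw [← mul_assoc, Units.inv_mul, one_mul]

/-- **DESCENT to a power of `p`** (strongest form of the slack): a 2-adic slack along an `act`-compatible map `f` is a
`p^v`-slack, `v = v_p(a)`. -/
theorem exists_pow_slack_of_padicInt_slack (act : ℤ_[p] → H → H) (f : H → M)
    (hf : ∀ (a : ℤ_[p]) (x : H), f (act a x) = a • f x) {χ : M}
    (h : ∃ a : ℤ_[p], a ≠ 0 ∧ ∃ x : H, a • χ = f x) :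
    ∃ v : ℕ, ∃ x : H, ((p : ℤ_[p]) ^ v) • χ = f x := by
  obtain ⟨a, ha, x, hx⟩ := h
  refine ⟨a.valuation, act (((PadicInt.unitCoeff ha)⁻¹ : ℤ_[p]ˣ) : ℤ_[p]) x, ?_⟩
  rw [hf, ← hx, ← mul_smul, unitCoeff_inv_mul_eq_pow ha]

/-- The same with a side condition `P` stable under `act` (shape of S4₂'s `locdS x = 0 ∧ a • z = locd₂ x`). -/
theorem exists_pow_slack_of_padicInt_slack_of_stable (act : ℤ_[p] → H → H) (f : H → M)
    (hf : ∀ (a : ℤ_[p]) (x : H), f (act a x) = a • f x) (P : H → Prop) (hP : ∀ (a : ℤ_[p]) (x : H), P x → P (act a x))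
    {z : M} (h : ∃ a : ℤ_[p], a ≠ 0 ∧ ∃ x : H, P x ∧ a • z = f x) :
    ∃ v : ℕ, ∃ x : H, P x ∧ ((p : ℤ_[p]) ^ v) • z = f x := by
  obtain ⟨a, ha, x, hPx, hx⟩ := h
  refine ⟨a.valuation, act (((PadicInt.unitCoeff ha)⁻¹ : ℤ_[p]ˣ) : ℤ_[p]) x, hP _ _ hPx, ?_⟩
  rw [hf, ← hx, ← mul_smul, unitCoeff_inv_mul_eq_pow ha]

/-- `((p : ℤ) ^ v : ℤ)`, cast to `ℤ_[p]`, is `(p : ℤ_[p]) ^ v`, and its `ℤ`-action is the cast action. -/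
theorem int_pow_smul_eq (v : ℕ) (χ : M) : (((p : ℤ) ^ v : ℤ)) • χ = ((p : ℤ_[p]) ^ v) • χ := by
  rw [← Int.cast_smul_eq_zsmul ℤ_[p] ((p : ℤ) ^ v) χ, Int.cast_pow, Int.cast_natCast]

theorem int_pow_ne_zero (v : ℕ) : ((p : ℤ) ^ v : ℤ) ≠ 0 :=
  pow_ne_zero _ (by exact_mod_cast (Fact.out : p.Prime).ne_zero)

/-- **DESCENT to `ℤ`**: a 2-adic slack along an `act`-compatible map is an integer slack. -/
theorem exists_int_slack_of_padicInt_slack (act : ℤ_[p] → H → H) (f : H → M)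
    (hf : ∀ (a : ℤ_[p]) (x : H), f (act a x) = a • f x) {χ : M}
    (h : ∃ a : ℤ_[p], a ≠ 0 ∧ ∃ x : H, a • χ = f x) :
    ∃ m : ℤ, m ≠ 0 ∧ ∃ x : H, m • χ = f x := by
  obtain ⟨v, x, hx⟩ := exists_pow_slack_of_padicInt_slack act f hf h
  exact ⟨(p : ℤ) ^ v, int_pow_ne_zero v, x, by rw [int_pow_smul_eq, hx]⟩

/-- **DESCENT to `ℤ`, with a stable side condition.** -/
theorem exists_int_slack_of_padicInt_slack_of_stable (act : ℤ_[p] → H → H) (f : H → M)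
    (hf : ∀ (a : ℤ_[p]) (x : H), f (act a x) = a • f x) (P : H → Prop) (hP : ∀ (a : ℤ_[p]) (x : H), P x → P (act a x))
    {z : M} (h : ∃ a : ℤ_[p], a ≠ 0 ∧ ∃ x : H, P x ∧ a • z = f x) :
    ∃ m : ℤ, m ≠ 0 ∧ ∃ x : H, P x ∧ m • z = f x := by
  obtain ⟨v, x, hPx, hx⟩ := exists_pow_slack_of_padicInt_slack_of_stable act f hf P hP h
  exact ⟨(p : ℤ) ^ v, int_pow_ne_zero v, x, hPx, by rw [int_pow_smul_eq, hx]⟩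

/-- **ASCENT**: an integer slack is a 2-adic slack (the cast; no compatibility needed). -/
theorem exists_padicInt_slack_of_int_slack (f : H → M) {χ : M}
    (h : ∃ m : ℤ, m ≠ 0 ∧ ∃ x : H, m • χ = f x) :
    ∃ a : ℤ_[p], a ≠ 0 ∧ ∃ x : H, a • χ = f x := by
  obtain ⟨m, hm, x, hx⟩ := h
  exact ⟨(m : ℤ_[p]), Int.cast_ne_zero.mpr hm, x, by rw [Int.cast_smul_eq_zsmul]; exact hx⟩

theorem exists_padicInt_slack_of_int_slack_of_stable (f : H → M) (P : H → Prop) {z : M}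
    (h : ∃ m : ℤ, m ≠ 0 ∧ ∃ x : H, P x ∧ m • z = f x) :
    ∃ a : ℤ_[p], a ≠ 0 ∧ ∃ x : H, P x ∧ a • z = f x := by
  obtain ⟨m, hm, x, hPx, hx⟩ := h
  exact ⟨(m : ℤ_[p]), Int.cast_ne_zero.mpr hm, x, hPx, by rw [Int.cast_smul_eq_zsmul]; exact hx⟩

/-- **THE EQUIVALENCE** (weakest = strongest): along an `act`-compatible map, «2-adic slack ⟺ integer slack». -/
theorem padicInt_slack_iff_int_slack (act : ℤ_[p] → H → H) (f : H → M)
    (hf : ∀ (a : ℤ_[p]) (x : H), f (act a x) = a • f x) (χ : M) :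
    (∃ a : ℤ_[p], a ≠ 0 ∧ ∃ x : H, a • χ = f x) ↔ (∃ m : ℤ, m ≠ 0 ∧ ∃ x : H, m • χ = f x) :=
  ⟨exists_int_slack_of_padicInt_slack act f hf, exists_padicInt_slack_of_int_slack f⟩

/-- … and «2-adic slack ⟺ power-of-`p` slack». -/
theorem padicInt_slack_iff_pow_slack (act : ℤ_[p] → H → H) (f : H → M)
    (hf : ∀ (a : ℤ_[p]) (x : H), f (act a x) = a • f x) (χ : M) :
    (∃ a : ℤ_[p], a ≠ 0 ∧ ∃ x : H, a • χ = f x) ↔ (∃ v : ℕ, ∃ x : H, ((p : ℤ_[p]) ^ v) • χ = f x) :=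
  ⟨exists_pow_slack_of_padicInt_slack act f hf, fun ⟨v, x, hx⟩ ↦
    ⟨(p : ℤ_[p]) ^ v, pow_ne_zero _ (by exact_mod_cast (Fact.out : p.Prime).ne_zero), x, hx⟩⟩

end Generic

/-! ## §2 The line's currency: S4₀'s and S4₂'s registered conclusions, descended to integer slack -/

section OnePairLine

open Literature.NumberTheory.EllipticCurves Literature.NumberTheory.EllipticCurves.GreenbergSelmer
open Literature.NumberTheory.GaloisRepresentations NumberField IsDedekindDomain Field
open Kobayashi2003 Rat.HeightOneSpectrum PowerSeries
open Summit.BirchSwinnertonDyer.BirchSwinnertonDyer.Theorems.OnePair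

variable (S : Set (PadicAlgCl 2)) (κ : ZpExtension ℚ 2) (ρ : FramedGaloisRep ℚ ↥(padicCoeffIntegers S) 2)
  (S₀ : Finset (HeightOneSpectrum (𝓞 ℚ)))
  (W : WeierstrassCurve ℚ) [W.IsElliptic] (γ : absoluteGaloisGroup ℚ) (n : ℕ)
  (Θ : ∀ v : HeightOneSpectrum (𝓞 ℚ), ((2 : ℕ) : 𝓞 ℚ) ∈ v.asIdeal → (Cofree ρ ↥(padicCoeffField S) ≃+ (Fin n → ↥(W.geomPrimaryTorsion 2))))
  (hΘ : ∀ v hv (δ : absoluteGaloisGroup (v.adicCompletion ℚ)) m i,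
    Θ v hv (resGalOfEmb (closureEmb (K := ℚ) (v.adicCompletion ℚ)) δ • m) i = resGalOfEmb (closureEmb (K := ℚ) (v.adicCompletion ℚ)) δ • Θ v hv m i)
  (I : Kato2004.IwasawaH1DataCoeff (FramedGaloisRep.toGaloisRep ρ) 2 κ γ)
  (Sg : AddSubgroup (subgroupH1 κ.kerSubgroup (Cofree ρ ↥(padicCoeffField S)))) [Module ↥(padicCoeffIntegers S) ↥Sg]
  (π : OnePairPins S W κ γ S₀ n ρ Θ hΘ I Sg) [∀ w : ↥S₀, Module ℤ_[2] (Dloc S κ ρ (w : HeightOneSpectrum (𝓞 ℚ)))]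

/-- The `ℤ₂`-action on `𝐇¹ = I.H` through `C ∘ (ℤ₂ → 𝒪)` — exactly the scalar of `AwayPins.hlocdS_smul`. A bare function (no instance). -/
def actH (a : ℤ_[2]) (x : I.H) : I.H :=
  (PowerSeries.C (padicIntToCoeffIntegers S a) : IwasawaAlgebraO S) • x

/-- **S4₀ descended**: the registered conclusion of `stub_deepHalfAwayTwo` (2-adic slack on `P_{S₀}`) gives the INTEGER slack the
`A := ℤ` place cut consumes — from the package field `AwayPins.hlocdS_smul` alone. -/
theorem awayPins_exists_int_slack (πₐ : AwayPins S κ ρ S₀ W γ n Θ hΘ I Sg π) {χ : PAway S κ ρ S₀}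
    (h : ∃ a : ℤ_[2], a ≠ 0 ∧ ∃ x : I.H, a • χ = πₐ.locdS x) :
    ∃ m : ℤ, m ≠ 0 ∧ ∃ x : I.H, m • χ = πₐ.locdS x :=
  exists_int_slack_of_padicInt_slack (actH S κ ρ γ I) πₐ.locdS (fun a x ↦ πₐ.hlocdS_smul a x) h

/-- … and the power-of-`2` form (`m = 2^v`). -/
theorem awayPins_exists_pow_slack (πₐ : AwayPins S κ ρ S₀ W γ n Θ hΘ I Sg π) {χ : PAway S κ ρ S₀}
    (h : ∃ a : ℤ_[2], a ≠ 0 ∧ ∃ x : I.H, a • χ = πₐ.locdS x) :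
    ∃ v : ℕ, ∃ x : I.H, ((2 : ℤ_[2]) ^ v) • χ = πₐ.locdS x := by
  simpa using exists_pow_slack_of_padicInt_slack (actH S κ ρ γ I) πₐ.locdS (fun a x ↦ πₐ.hlocdS_smul a x) h

/-- **S4₀ ⟺ S4₀_ℤ** on each character: the registered 2-adic reading and the integer reading are equivalent. -/
theorem awayPins_slack_iff (πₐ : AwayPins S κ ρ S₀ W γ n Θ hΘ I Sg π) (χ : PAway S κ ρ S₀) :
    (∃ a : ℤ_[2], a ≠ 0 ∧ ∃ x : I.H, a • χ = πₐ.locdS x) ↔ (∃ m : ℤ, m ≠ 0 ∧ ∃ x : I.H, m • χ = πₐ.locdS x) :=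
  padicInt_slack_iff_int_slack (actH S κ ρ γ I) πₐ.locdS (fun a x ↦ πₐ.hlocdS_smul a x) χ

/-- **S4₂ descended**: the registered conclusion of `stub_deepHalfAtTwoStrict` (2-adic slack on `𝔉₂ = (E(ℚ_{∞,v})ⁿ →+ ℤ₂)`, side condition
`locdS x = 0`) gives the integer slack, granted the `ℤ₂`-compatibility of `π.locd₂` (the landed `locd₂_C_smul_eq_smul` for the line's `locd₂`). -/
theorem atTwo_exists_int_slack (πₐ : AwayPins S κ ρ S₀ W γ n Θ hΘ I Sg π)
    (hlocd₂ : ∀ (a : ℤ_[2]) (x : I.H),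
      π.locd₂ ((PowerSeries.C (padicIntToCoeffIntegers S a) : IwasawaAlgebraO S) • x) = a • π.locd₂ x)
    {z : (Fin n → ↥(Sprung2012.localTowerPointsOfEmb κ (closureEmb (K := ℚ) (π.v.adicCompletion ℚ)) W)) →+ ℤ_[2]}
    (h : ∃ a : ℤ_[2], a ≠ 0 ∧ ∃ x : I.H, πₐ.locdS x = 0 ∧ a • z = π.locd₂ x) :
    ∃ m : ℤ, m ≠ 0 ∧ ∃ x : I.H, πₐ.locdS x = 0 ∧ m • z = π.locd₂ x :=
  exists_int_slack_of_padicInt_slack_of_stable (actH S κ ρ γ I) π.locd₂ (fun a x ↦ hlocd₂ a x)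
    (fun x ↦ πₐ.locdS x = 0) (fun a x hx ↦ by
      show πₐ.locdS ((PowerSeries.C (padicIntToCoeffIntegers S a) : IwasawaAlgebraO S) • x) = 0
      rw [πₐ.hlocdS_smul, hx, smul_zero]) h

/-- **ASCENT at the end of the chain**: the `A := ℤ` output of the relaxed deep half (integer slack on `P`) is N5's 2-adic slack. -/
theorem n5_slack_of_int_slack {P : Type*} [AddCommGroup P] [Module ℤ_[2] P] (locd : I.H → P) {z : P}
    (h : ∃ m : ℤ, m ≠ 0 ∧ ∃ x : I.H, m • z = locd x) :
    ∃ a : ℤ_[2], a ≠ 0 ∧ ∃ x : I.H, a • z = locd x :=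
  exists_padicInt_slack_of_int_slack locd h

end OnePairLine

end Summit.BirchSwinnertonDyer.BirchSwinnertonDyer.Cruxes.ResidualThetaCountLowerPureAtTwo.SideaK1G20

end
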